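import Literature.MathematicalPhysics.QuantumFieldTheory.Balaban1983to89.B9SmoothHolderClassGraded
import Literature.MathematicalPhysics.QuantumFieldTheory.Balaban1983to89.B9SmoothHolderClassSReadings
import Literature.MathematicalPhysics.QuantumFieldTheory.Balaban1983to89.B9GradViaDivLettersSmoothTerms

/-!
# `Balaban1983to89.B9SmoothHolderClassTReadings` — the class axiom `hX` and the cost binder `hκX` of the re-cut letters AT THE GRADED TRANSPORTED BOND PIN
# `bXH := bHZKG (taxiB U) p w`: the identity map from the (graded, transported) smooth Hölder class of the BOND coordinate carrier into the sharp
# `(Lʲη)^{−1}`-weighted sup class `𝔠⁽¹⁾ = cNorm … (blkBK bI) 1` — the bond-carrier twins of g20's `B9SmoothHolderClassSReadings.hasMaj_id_bHZ_cNorm`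

T. Bałaban, *Propagators for lattice gauge theories in a background field*, Commun. Math. Phys. **99** (1985) 389–434
[`Balaban1985BackgroundPropagators`, "B9"]; [4] = T. Bałaban, *Propagators and renormalization transformations for lattice gauge
theories. II*, Commun. Math. Phys. **96** (1984) 223–250 [`Balaban1984PropagatorsII`].

statement-level skeleton of published theorems with citation tags; proofs where landed; nothing here is a claim about the
Yang–Mills mass gap

THE PRINTED LOCI.  [B9] (3.41)–(3.42) p. 397, (3.43)–(3.45) p. 398 (*"supp λ ⊂ Δ̃(y′)"*, *"(‖λ‖ + |λ|)"*); [4] (2.51)–(2.54) p. 232.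

WHY THIS FILE (cell `pub-ymgap`, node N06, seat dag-n06-l g21; OPTION (2) + LOCATED-U5).  The re-cut letters' class axiom `hX : HasMaj bXH (cNorm blk 1) id (κX·e^{−δX d})`
(`B9Thm313WholeCutLettersSupFrom344`) lives on the BOND carrier `XBK` (`𝔬.blk = blkBK bI`); g20's reading was typed on the site carrier.  Here: ★★ `hasMaj_id_bHZKT_cNorm` — for
every transporter table `g`, exponent `0 ≤ ε ≤ 1 ≤ p`, the identity `bHZKT g ε p → cNorm (blkBK bI) 1` has majorant `L·e^{δr}·e^{−δd}` (only the SUP part of the class is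
read: a bond vector localised at `y′` vanishes at bonds sourced off `Δ̃(y′)`; a block carrying a nonzero value has its bond's source in `Δ̃(y′)`, so `d ≤ r` (LAYER B) and
`j(y) ≥ j(y′) − 1`); ★★ `hasMaj_id_bHZKG_cNorm` — the same OUT OF THE GRADED class at any exponent `s` with `0 < w s` (constant `(w s)⁻¹·L·e^{δr}`); `bHZKT_κ_le`, `bHZKG_κ_le`
(`hκX` with `κ13 := 1 + C_Lip`).
HONEST SCOPE.  Bookkeeping over landed definitions; the radius `r` displayed (LAYER B discharges it); nothing of [B9]∕[4] asserted; no certificate edit; COUNT-NEUTRAL;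
N06 NOT discharged; nothing continuum, nothing about the mass gap.  Cell `pub-ymgap` (HUMAN RULING D-0062), Track A node N06 [B9], seat `pub-ymgap-dag-n06-l` (g21), 2026-08-28.
-/

noncomputable section

namespace Literature.MathematicalPhysics.QuantumFieldTheory.Balaban1983to89.B9SmoothHolderClassTReadings

open B6Geom246MultiLevelTorus (bondT)
open B6GlobalChartV1 (PV blkV1)
open B6Ineq2142KLevelV1 (β lvl)
open B6KLevelCensusIndexV1 (KIdx)
open B6Prop22KLevelTorusCensusEta (nKT one_le_nKT)
open B9GeoNormsKLevelV1 (geo9K)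
open B9Thm34Ext (toB6)
open B11SectG (BlockNorm HasMaj)
open B11SectGGlobal (Size)
open B11SectGGlobalSizes
open B9SectDSup (weightNorm)
open B9Thm312Whole (cNorm wt)
open B9CoReadingCoords (XBK blkBK)
open B9CoReadingCoordsS (XSK sIK)
open B9GradViaDivLettersAtPinsHolderPairs (sIK_chartY)
open B9MultiscaleSmoothPartitionY (scl scl_pos NearY levY_window_of_nearY)
open B9MultiscaleSmoothPartitionYLip (CLip)
open B9SmoothHolderClassS (Wscl Wscl_nonneg Wscl_mono)
open B9SmoothHolderClassK (srcY)
open B9SmoothHolderClassT (bHZKT bHZKT_κ bHZKT_loc bHZKT_isLoc_iff)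
open B9SmoothHolderClassGraded (bHZKG bHZKG_κ hasMaj_from_bHZKG)
open B9SmoothHolderClassSReadings (wt_one_eq Wscl_one_eq)
open B9GradViaDivLettersSmoothTerms (blkV1_level_eq_levY)
open Node00 (SiteY FBondY IBondY toKT levY)

variable {d ℓ : ℕ} {hd : 1 ≤ d + 1} {hL : Odd (ℓ + 1) ∧ 1 < ℓ + 1} {b₀ b₁ : ℝ}
variable {𝔸 : Type} [NormedRing 𝔸] [NormedAlgebra ℂ 𝔸]
variable {κ : Type} [Fintype κ]
variable (i : KIdx d ℓ hd hL b₀ b₁) [Fintype (geo9K i).Site] (b : Module.Basis κ ℝ 𝔸)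

open Classical in
/-- the sharp-block sup of a bond vector vanishing at bonds sourced off `Δ̃(y′)` is below its `Δ̃(y′)`-sup size. [cite: Balaban1985BackgroundPropagators, (3.44) p.398 + p.398 (remark after (3.47)), bookkeeping] -/
theorem ofBlocks_loc_le_ofSup_bond {R : ℝ} {H : Prop} (blk : XBK κ i → IBondY i) {y' : IBondY i} {μ : XBK κ i → ℝ}
    (hμ : ∀ q : XBK κ i, ¬ NearY i y' (srcY i q) → μ q = 0) (y : IBondY i) :
    (BlockNorm.ofBlocks (toB6 (geo9K i) R H) blk).loc y μ ≤
      (Size.ofSup (toB6 (geo9K i) R H) (fun (q : XBK κ i) (y : IBondY i) => NearY i y (srcY i q))).sz y' μ := by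
  show (⨆ q : XBK κ i, @ite ℝ (blk q = y) (Classical.propDecidable _) |μ q| 0) ≤ _
  refine Real.iSup_le (fun q => ?_) (Size.nonneg _ _ _)
  split_ifs with hq
  · by_cases hμq : μ q = 0
    · rw [hμq, abs_zero]; exact Size.nonneg _ _ _
    · exact ofSup_abs_le _ (show NearY i y' (srcY i q) from by by_contra hn; exact hμq (hμ q hn)) μ
  · exact Size.nonneg _ _ _

omit [NormedAlgebra ℂ 𝔸] [NormedRing 𝔸] in
/-- … and vanishes when no bond of the block carries a nonzero value. [cite: Balaban1984PropagatorsII, (2.51) p.232, bookkeeping] -/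
theorem ofBlocks_loc_eq_zero_bond {R : ℝ} {H : Prop} (blk : XBK κ i → IBondY i) {y : IBondY i} {μ : XBK κ i → ℝ}
    (h : ∀ q : XBK κ i, blk q = y → μ q = 0) : (BlockNorm.ofBlocks (toB6 (geo9K i) R H) blk).loc y μ = 0 := by
  refine le_antisymm ?_ ((BlockNorm.ofBlocks (toB6 (geo9K i) R H) blk).loc_nonneg y μ)
  show (⨆ q : XBK κ i, @ite ℝ (blk q = y) (Classical.propDecidable _) |μ q| 0) ≤ 0
  refine Real.iSup_le (fun q => ?_) le_rfl
  split_ifs with hq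
  · rw [h q hq, abs_zero]
  · exact le_rfl

/-- ★★ **THE CLASS AXIOM `hX` AT A TRANSPORTED BOND CLASS**: for every transporter table `g` and `0 ≤ ε ≤ 1 ≤ p` (`ε ≤ p`), the identity map `bHZKT g ε p → 𝔠⁽¹⁾ = cNorm (blkBK bI) 1`
has the majorant `L·e^{δr}·e^{−δ·d(y,y′)}` for every `δ ≥ 0` — only the SUP part of the class is read (a bond vector localised at `y′` vanishes at bonds sourced off `Δ̃(y′)`; a block `y`
carrying a nonzero value has its bond's source in `Δ̃(y′)`, whence `d(y,y′) ≤ r` — the displayed enlargement radius `hN`, discharged by LAYER B — and `j(y) ≥ j(y′) − 1`).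
[cite: Balaban1985BackgroundPropagators, (3.41)–(3.42) p.397 + (3.44) p.398 + p.398 (remark after (3.47)); Balaban1984PropagatorsII, (2.51)–(2.54) p.232] -/
theorem hasMaj_id_bHZKT_cNorm (g : FBondY i → FBondY i → 𝔸ˣ) {R : ℝ} {H : Prop} {ε p : ℝ} (hε0 : 0 ≤ ε) (hε1 : ε ≤ 1) (hεp : ε ≤ p) (h1p : 1 ≤ p)
    (hlen : ∀ y : (geo9K i).Site, 0 ≤ (geo9K i).len y) {bI : FBondY i → IBondY i}
    (hlev : ∀ f : FBondY i, lvl i.hN i.D i.hk (bI f) = (blkV1 i.hN i.D f).1.1) (hbI0 : ∀ f : FBondY i, bI f = bI ⟨f.src, 0⟩)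
    {r δ : ℝ} (hδ : 0 ≤ δ) (hN : ∀ (y : IBondY i) (z : SiteY i), NearY i y z → (geo9K i).dist y (sIK i bI z) ≤ r)
    (hcf : |i.cf| ≤ (nKT (toKT i) : ℝ)) :
    HasMaj (bHZKT (κ := κ) i b g (R := R) (H := H) hε0 hε1 hεp) (cNorm R H (blkBK i bI) hlen 1) LinearMap.id
      (fun y y' => (((ℓ + 1 : ℕ) : ℝ)) * Real.exp (δ * r) * Real.exp (-(δ * (geo9K i).dist y y'))) := by
  classical
  intro y' μ hμ y
  rw [bHZKT_isLoc_iff] at hμ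
  rw [LinearMap.id_apply]
  have hL0 : (0 : ℝ) ≤ ((ℓ + 1 : ℕ) : ℝ) := Nat.cast_nonneg _
  have hL1 : (1 : ℝ) ≤ ((ℓ + 1 : ℕ) : ℝ) := by exact_mod_cast Nat.succ_le_succ (Nat.zero_le ℓ)
  have hloc0 : 0 ≤ (bHZKT (κ := κ) i b g (R := R) (H := H) hε0 hε1 hεp).loc y' μ := BlockNorm.loc_nonneg _ _ _
  have hK0 : 0 ≤ (((ℓ + 1 : ℕ) : ℝ)) * Real.exp (δ * r) * Real.exp (-(δ * (geo9K i).dist y y')) := by positivity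
  have hcN : (cNorm R H (blkBK i bI) hlen 1).loc y μ = wt (geo9K i) 1 y * (BlockNorm.ofBlocks (toB6 (geo9K i) R H) (blkBK i bI)).loc y μ := rfl
  by_cases hex : ∃ q : XBK κ i, blkBK i bI q = y ∧ μ q ≠ 0
  · obtain ⟨q, hq, hμq⟩ := hex
    have hnear : NearY i y' (srcY i q) := by by_contra hn; exact hμq (hμ q hn)
    -- the carrier bond of the source site IS `bI q.1` (direction-blind `bI`)
    have hsrc : sIK i bI (srcY i q) = bI q.1 := by rw [srcY, sIK_chartY, ← hbI0 q.1]
    have hdist : (geo9K i).dist y y' ≤ r := by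
      have h := hN y' (srcY i q) hnear
      have hsym : (geo9K i).dist y y' = (geo9K i).dist y' y := by
        show (((bondT i.D).dist _ _ : ℕ) : ℝ) = (((bondT i.D).dist _ _ : ℕ) : ℝ)
        rw [SimpleGraph.dist_comm]
      rw [hsym, ← hq]; rw [hsrc] at h; exact h
    have hexp : 1 ≤ Real.exp (δ * r) * Real.exp (-(δ * (geo9K i).dist y y')) := by
      rw [← Real.exp_add]; exact Real.one_le_exp (by nlinarith)
    -- levels: `j(y) = lev (src q) ≥ j(y′) − 1`
    have hly : lvl i.hN i.D i.hk y = levY i (srcY i q) := by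
      rw [← hq]; exact (hlev q.1).trans (blkV1_level_eq_levY i q)
    have hwin := (levY_window_of_nearY i hnear).1
    rw [← hly] at hwin
    have hs := scl_pos i y
    have hs' := scl_pos i y'
    have hscl : scl i y' ≤ ((ℓ + 1 : ℕ) : ℝ) * scl i y := by
      rw [scl, scl, ← pow_succ']; exact pow_le_pow_right₀ hL1 hwin
    have hwt : wt (geo9K i) 1 y ≤ ((ℓ + 1 : ℕ) : ℝ) * Wscl i p y' := by
      have h1 : wt (geo9K i) 1 y ≤ ((ℓ + 1 : ℕ) : ℝ) * Wscl i 1 y' := by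
        rw [wt_one_eq, Wscl_one_eq, mul_div_assoc', div_le_div_iff₀ hs hs']
        calc |i.cf| * scl i y' ≤ (nKT (toKT i) : ℝ) * (((ℓ + 1 : ℕ) : ℝ) * scl i y) :=
            mul_le_mul hcf hscl hs'.le (Nat.cast_nonneg _)
          _ = ((ℓ + 1 : ℕ) : ℝ) * (nKT (toKT i) : ℝ) * scl i y := by ring
      exact h1.trans (mul_le_mul_of_nonneg_left (Wscl_mono i h1p y') hL0)
    have hsup := ofBlocks_loc_le_ofSup_bond i (R := R) (H := H) (blkBK (κ := κ) i bI) hμ y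
    have hbT : Wscl i p y' * (Size.ofSup (toB6 (geo9K i) R H) (fun (q : XBK κ i) (y : IBondY i) => NearY i y (srcY i q))).sz y' μ ≤
        (bHZKT (κ := κ) i b g (R := R) (H := H) hε0 hε1 hεp).loc y' μ := by
      rw [bHZKT_loc]; exact le_add_of_nonneg_right (Size.nonneg _ _ _)
    calc (cNorm R H (blkBK i bI) hlen 1).loc y μ
        = wt (geo9K i) 1 y * (BlockNorm.ofBlocks (toB6 (geo9K i) R H) (blkBK i bI)).loc y μ := hcN
      _ ≤ (((ℓ + 1 : ℕ) : ℝ) * Wscl i p y') *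
            (Size.ofSup (toB6 (geo9K i) R H) (fun (q : XBK κ i) (y : IBondY i) => NearY i y (srcY i q))).sz y' μ :=
          mul_le_mul hwt hsup (BlockNorm.loc_nonneg _ _ _) (mul_nonneg hL0 (Wscl_nonneg i p y'))
      _ ≤ ((ℓ + 1 : ℕ) : ℝ) * (bHZKT (κ := κ) i b g (R := R) (H := H) hε0 hε1 hεp).loc y' μ := by rw [mul_assoc]; exact mul_le_mul_of_nonneg_left hbT hL0
      _ ≤ ((ℓ + 1 : ℕ) : ℝ) * (Real.exp (δ * r) * Real.exp (-(δ * (geo9K i).dist y y'))) * (bHZKT (κ := κ) i b g (R := R) (H := H) hε0 hε1 hεp).loc y' μ := by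
          rw [mul_assoc (((ℓ + 1 : ℕ) : ℝ))]
          exact mul_le_mul_of_nonneg_left (le_mul_of_one_le_left hloc0 hexp) hL0
      _ = _ := by ring
  · push Not at hex
    rw [hcN, ofBlocks_loc_eq_zero_bond i (R := R) (H := H) (blkBK (κ := κ) i bI) hex, mul_zero]
    exact mul_nonneg hK0 hloc0

/-- ★★ **`hX` OUT OF THE GRADED TRANSPORTED BOND CLASS** at any exponent `0 < s < 1` with `0 < w s`: constant `(w s)⁻¹·L·e^{δr}`.
[cite: Balaban1985BackgroundPropagators, (3.41)–(3.42) p.397 + (3.44)–(3.45) p.398; Balaban1984PropagatorsII, (2.51)–(2.54) p.232] -/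
theorem hasMaj_id_bHZKG_cNorm (g : FBondY i → FBondY i → 𝔸ˣ) {R : ℝ} {H : Prop} {p : ℝ} (h1p : 1 ≤ p) (w : ℝ → ℝ) (hw0 : ∀ s, 0 ≤ w s) (hw1 : ∀ s, w s ≤ 1)
    {s : ℝ} (hs0 : 0 < s) (hs1 : s < 1) (hws : 0 < w s)
    (hlen : ∀ y : (geo9K i).Site, 0 ≤ (geo9K i).len y) {bI : FBondY i → IBondY i}
    (hlev : ∀ f : FBondY i, lvl i.hN i.D i.hk (bI f) = (blkV1 i.hN i.D f).1.1) (hbI0 : ∀ f : FBondY i, bI f = bI ⟨f.src, 0⟩)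
    {r δ : ℝ} (hδ : 0 ≤ δ) (hN : ∀ (y : IBondY i) (z : SiteY i), NearY i y z → (geo9K i).dist y (sIK i bI z) ≤ r)
    (hcf : |i.cf| ≤ (nKT (toKT i) : ℝ)) :
    HasMaj (bHZKG (κ := κ) i b g (R := R) (H := H) h1p w hw0 hw1) (cNorm R H (blkBK i bI) hlen 1) LinearMap.id
      (fun y y' => (w s)⁻¹ * ((((ℓ + 1 : ℕ) : ℝ)) * Real.exp (δ * r) * Real.exp (-(δ * (geo9K i).dist y y')))) :=
  hasMaj_from_bHZKG i b h1p w hw0 hw1 g hs0 hs1 hws (fun _ _ => by positivity)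
    (hasMaj_id_bHZKT_cNorm i b g hs0.le hs1.le (hs1.le.trans h1p) h1p hlen hlev hbI0 hδ hN hcf)

/-- ★ the uniform cutting-cost binder `hκX` at a transported bond class: `κ = 1 + C_Lip`. [cite: Balaban1984PropagatorsII, (2.52) p.232; Balaban1985BackgroundPropagators, (3.43) p.398] -/
theorem bHZKT_κ_le (g : FBondY i → FBondY i → 𝔸ˣ) {R : ℝ} {H : Prop} {ε p : ℝ} (hε0 : 0 ≤ ε) (hε1 : ε ≤ 1) (hεp : ε ≤ p) :
    (bHZKT (κ := κ) i b g (R := R) (H := H) hε0 hε1 hεp).κ ≤ 1 + CLip d ℓ := le_of_eq (bHZKT_κ i b g hε0 hε1 hεp)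

/-- ★ … and at the graded transported bond class. [cite: Balaban1984PropagatorsII, (2.52) p.232; Balaban1985BackgroundPropagators, (3.43) p.398] -/
theorem bHZKG_κ_le (g : FBondY i → FBondY i → 𝔸ˣ) {R : ℝ} {H : Prop} {p : ℝ} (h1p : 1 ≤ p) (w : ℝ → ℝ) (hw0 : ∀ s, 0 ≤ w s) (hw1 : ∀ s, w s ≤ 1) :
    (bHZKG (κ := κ) i b g (R := R) (H := H) h1p w hw0 hw1).κ ≤ 1 + CLip d ℓ := le_of_eq (bHZKG_κ i b h1p w hw0 hw1 g)

end Literature.MathematicalPhysics.QuantumFieldTheory.Balaban1983to89.B9SmoothHolderClassTReadings
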